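import Summits.NavierStokesRegularity.NavierStokesRegularity.Theorems.GaldiLiouvilleGateAllAxesCylTest
import Summits.NavierStokesRegularity.NavierStokesRegularity.Theorems.GaldiLiouvilleGateAllAxesBudgetProfile
import Summits.NavierStokesRegularity.NavierStokesRegularity.Theorems.GaldiLiouvilleGateAllAxesBudgetDensity
import HarnessLib

/-!
# Galdi's Liouville problem ⟨0895⟩, line «all-axes cylinder budget», piece O1c (5b/·): tools for the
# one-stroke cylinder inequality — compact solid cylinders, and the abstract zone bookkeeping

Route `GaldiLiouvilleGate`, items ⟨0895⟩/⟨0896⟩; LINE allaxes/cylbudget, combined Defs v3.1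
(817120c4c833a18a), obligation O1c′ `CylinderBookkeepingSplit`.  Small tools (`deriv_deriv_eq_zero_of_eventually_const`,
`isCompact_solidCylinder`, `integrableOn_of_continuousOn_compact_vanish`, `norm_sq_fin3`) and the two abstract
integration steps of the one-stroke argument: `setIntegral_le_of_zones` (`∫F = 0`, `g ≤ E − F` on the core,
`F − E ≤ Σ 1_{Zᵢ}Bᵢ` off it ⇒ `∫_{S₀} g ≤ Σ∫_{Zᵢ}Bᵢ + ∫E`) and `integral_le_of_abs_le_on`.

[folklore]  No summit / no ⟨0895⟩–⟨0896⟩ claim is proved here; NS regularity is not touched.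
-/

noncomputable section

-- the problem directory repeats the summit name (D-0017); core's `dupNamespace` linter fires
set_option linter.dupNamespace false

open MeasureTheory Set Filter Topology InnerProductSpace Function Metric
open scoped RealInnerProductSpace Laplacian Topology ENNReal

namespace Summit.NavierStokesRegularity.NavierStokesRegularity.Theorems.GaldiLiouville.AllAxesBudget

open Literature.Analysis.FluidPDE

/-! ### Small tools -/

/-- A smooth one-variable function that is constant on an open set has vanishing first and second
derivative there. [folklore] -/
theorem deriv_deriv_eq_zero_of_eventually_const {f : ℝ → ℝ} {z a : ℝ} (h : f =ᶠ[𝓝 z] fun _ => a) :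
    deriv f z = 0 ∧ deriv (deriv f) z = 0 := by
  have h1 : deriv f =ᶠ[𝓝 z] fun _ => (0 : ℝ) := by
    filter_upwards [eventually_eventually_nhds.2 h] with w hw
    have hw' : f =ᶠ[𝓝 w] fun _ => a := hw
    rw [hw'.deriv_eq, deriv_const]
  refine ⟨?_, ?_⟩
  · rw [h.deriv_eq, deriv_const]
  · rw [h1.deriv_eq, deriv_const]

/-- The set `{s ≤ a} ∩ {|x₂| ≤ b}` in `EuclideanSpace ℝ (Fin 3)` (`s = x₀² + x₁²`) is compact. [folklore] -/
theorem isCompact_solidCylinder (a b : ℝ) :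
    IsCompact {x : EuclideanSpace ℝ (Fin 3) | x 0 ^ 2 + x 1 ^ 2 ≤ a ∧ |x 2| ≤ b} := by
  have hc : ∀ i : Fin 3, Continuous fun y : EuclideanSpace ℝ (Fin 3) => y i := fun i =>
    (EuclideanSpace.proj (𝕜 := ℝ) i).continuous
  refine Metric.isCompact_of_isClosed_isBounded ?_ ?_
  · exact (isClosed_le (((hc 0).pow 2).add ((hc 1).pow 2)) continuous_const).inter
      (isClosed_le (continuous_abs.comp (hc 2)) continuous_const)
  · refine (Metric.isBounded_closedBall (x := (0 : EuclideanSpace ℝ (Fin 3))) (r := Real.sqrt (|a| + b ^ 2))).subset ?_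
    intro x hx
    rw [mem_closedBall, dist_zero_right]
    have hn : ‖x‖ ^ 2 = x 0 ^ 2 + x 1 ^ 2 + x 2 ^ 2 := by
      rw [EuclideanSpace.norm_sq_eq, Fin.sum_univ_three]; simp [Real.norm_eq_abs, sq_abs]
    have h2 : x 2 ^ 2 ≤ b ^ 2 := by
      have := hx.2; rw [← sq_abs]; exact pow_le_pow_left₀ (abs_nonneg _) this 2
    have : ‖x‖ ^ 2 ≤ |a| + b ^ 2 := by rw [hn]; linarith [hx.1, le_abs_self a]
    calc ‖x‖ = Real.sqrt (‖x‖ ^ 2) := (Real.sqrt_sq (norm_nonneg _)).symm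
      _ ≤ Real.sqrt (|a| + b ^ 2) := Real.sqrt_le_sqrt this

/-- Integrability on a set from continuity on a compact superset of the support inside the set:
if `f` is continuous on the compact `K ⊆ S` and vanishes on `S \ K`, then `f` is integrable on `S`. [folklore] -/
theorem integrableOn_of_continuousOn_compact_vanish {f : EuclideanSpace ℝ (Fin 3) → ℝ}
    {K S : Set (EuclideanSpace ℝ (Fin 3))} (hK : IsCompact K) (hS : MeasurableSet S)
    (hf : ContinuousOn f K) (h0 : ∀ x ∈ S \ K, f x = 0) : IntegrableOn f S volume :=
  (hf.integrableOn_compact hK).of_forall_sdiff_eq_zero hS h0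


/-! ### Abstract integration over the zones -/

/-- **Zone bookkeeping.**  `F, E` integrable with `∫ F = 0`; on `S₀ ⊆ Z₁`: `g ≤ E − F`, on `Z₁`:
`0 ≤ E − F`; off `Z₁`: `F − E ≤ 1_{Z₂}B₂ + 1_{Z₃}B₃ + 1_{Z₄}B₄` with `Bᵢ` integrable on `Zᵢ ⊆ Z₁ᶜ`.
Then `∫_{S₀} g ≤ ∫_{Z₂}B₂ + ∫_{Z₃}B₃ + ∫_{Z₄}B₄ + ∫ E`. [folklore] -/
theorem setIntegral_le_of_zones {α : Type*} [MeasurableSpace α] {μ : Measure α}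
    {F E g B₂ B₃ B₄ : α → ℝ} {S₀ Z₁ Z₂ Z₃ Z₄ : Set α}
    (hF : Integrable F μ) (hE : Integrable E μ) (hF0 : ∫ x, F x ∂μ = 0)
    (hS₀ : MeasurableSet S₀) (hZ₁ : MeasurableSet Z₁) (hZ₂ : MeasurableSet Z₂) (hZ₃ : MeasurableSet Z₃)
    (hZ₄ : MeasurableSet Z₄) (hsub : S₀ ⊆ Z₁) (h₂ : Z₂ ⊆ Z₁ᶜ) (h₃ : Z₃ ⊆ Z₁ᶜ) (h₄ : Z₄ ⊆ Z₁ᶜ)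
    (hg : IntegrableOn g S₀ μ) (hgS : ∀ x ∈ S₀, g x ≤ E x - F x) (hZ₁pos : ∀ x ∈ Z₁, 0 ≤ E x - F x)
    (hB₂ : IntegrableOn B₂ Z₂ μ) (hB₃ : IntegrableOn B₃ Z₃ μ) (hB₄ : IntegrableOn B₄ Z₄ μ)
    (hB : ∀ x, x ∉ Z₁ → F x - E x ≤ Z₂.indicator B₂ x + Z₃.indicator B₃ x + Z₄.indicator B₄ x) :
    ∫ x in S₀, g x ∂μ ≤ (∫ x in Z₂, B₂ x ∂μ) + (∫ x in Z₃, B₃ x ∂μ) + (∫ x in Z₄, B₄ x ∂μ) + ∫ x, E x ∂μ := by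
  have hEF : Integrable (fun x => E x - F x) μ := hE.sub hF
  -- `∫_{S₀} g ≤ ∫_{S₀} (E - F) ≤ ∫_{Z₁} (E - F)`
  have h1 : ∫ x in S₀, g x ∂μ ≤ ∫ x in S₀, (E x - F x) ∂μ :=
    setIntegral_mono_on hg hEF.integrableOn hS₀ hgS
  have h2 : ∫ x in S₀, (E x - F x) ∂μ ≤ ∫ x in Z₁, (E x - F x) ∂μ :=
    setIntegral_mono_set hEF.integrableOn
      ((ae_restrict_iff' hZ₁).2 (Eventually.of_forall hZ₁pos)) (Eventually.of_forall hsub)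
  -- `∫_{Z₁} (E - F) = ∫ E + ∫_{Z₁ᶜ} (F - E)`
  have h3 : ∫ x in Z₁, (E x - F x) ∂μ = (∫ x, E x ∂μ) + ∫ x in Z₁ᶜ, (F x - E x) ∂μ := by
    have hsplit := integral_add_compl hZ₁ hEF
    have htot : ∫ x, (E x - F x) ∂μ = ∫ x, E x ∂μ := by
      rw [integral_sub hE hF, hF0, sub_zero]
    have hneg : ∫ x in Z₁ᶜ, (F x - E x) ∂μ = -∫ x in Z₁ᶜ, (E x - F x) ∂μ := by
      rw [← integral_neg]; congr 1; funext x; ring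
    linarith
  -- `∫_{Z₁ᶜ} (F - E) ≤ ∫_{Z₁ᶜ} (Σ indicators) = Σ ∫_{Zᵢ} Bᵢ`
  have hBi : ∀ {Z : Set α} {B : α → ℝ}, MeasurableSet Z → IntegrableOn B Z μ →
      IntegrableOn (Z.indicator B) Z₁ᶜ μ := fun hZ hB =>
    (hB.integrable_indicator hZ).integrableOn
  have h4 : ∫ x in Z₁ᶜ, (F x - E x) ∂μ ≤
      ∫ x in Z₁ᶜ, (Z₂.indicator B₂ x + Z₃.indicator B₃ x + Z₄.indicator B₄ x) ∂μ :=
    setIntegral_mono_on (hF.sub hE).integrableOn (((hBi hZ₂ hB₂).add (hBi hZ₃ hB₃)).add (hBi hZ₄ hB₄))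
      hZ₁.compl fun x hx => hB x hx
  have h5 : ∫ x in Z₁ᶜ, (Z₂.indicator B₂ x + Z₃.indicator B₃ x + Z₄.indicator B₄ x) ∂μ =
      (∫ x in Z₂, B₂ x ∂μ) + (∫ x in Z₃, B₃ x ∂μ) + ∫ x in Z₄, B₄ x ∂μ := by
    have i2 := hBi hZ₂ hB₂
    have i3 := hBi hZ₃ hB₃
    have i4 := hBi hZ₄ hB₄
    have i23 : IntegrableOn (fun x => Z₂.indicator B₂ x + Z₃.indicator B₃ x) Z₁ᶜ μ := i2.add i3
    have e1 : ∫ x in Z₁ᶜ, (Z₂.indicator B₂ x + Z₃.indicator B₃ x + Z₄.indicator B₄ x) ∂μ =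
        (∫ x in Z₁ᶜ, (Z₂.indicator B₂ x + Z₃.indicator B₃ x) ∂μ) + ∫ x in Z₁ᶜ, Z₄.indicator B₄ x ∂μ :=
      integral_add i23 i4
    have e2 : ∫ x in Z₁ᶜ, (Z₂.indicator B₂ x + Z₃.indicator B₃ x) ∂μ =
        (∫ x in Z₁ᶜ, Z₂.indicator B₂ x ∂μ) + ∫ x in Z₁ᶜ, Z₃.indicator B₃ x ∂μ := integral_add i2 i3
    have hind : ∀ {Z : Set α} {B : α → ℝ}, MeasurableSet Z → Z ⊆ Z₁ᶜ →
        ∫ x in Z₁ᶜ, Z.indicator B x ∂μ = ∫ x in Z, B x ∂μ := fun {Z} {B} hZ hZs => by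
      rw [integral_indicator hZ, Measure.restrict_restrict hZ, inter_eq_left.2 hZs]
    rw [e1, e2, hind hZ₂ h₂, hind hZ₃ h₃, hind hZ₄ h₄]
  linarith

/-- **The cut-off error.**  If `E` vanishes off a measurable set `R` and `|E| ≤ C·p` on `R` with `p`
integrable on `R`, then `∫ E ≤ C ∫_R p`. [folklore] -/
theorem integral_le_of_abs_le_on {α : Type*} [MeasurableSpace α] {μ : Measure α}
    {E p : α → ℝ} {R : Set α} {C : ℝ} (hR : MeasurableSet R) (hE : Integrable E μ)
    (hp : IntegrableOn p R μ) (h0 : ∀ x, x ∉ R → E x = 0) (hb : ∀ x ∈ R, |E x| ≤ C * p x) :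
    ∫ x, E x ∂μ ≤ C * ∫ x in R, p x ∂μ := by
  have h1 : ∫ x, E x ∂μ = ∫ x in R, E x ∂μ :=
    (setIntegral_eq_integral_of_forall_compl_eq_zero h0).symm
  rw [h1, ← integral_const_mul]
  exact setIntegral_mono_on hE.integrableOn (hp.const_mul C) hR fun x hx => (le_abs_self _).trans (hb x hx)

/-! ### The core inequality -/
end Summit.NavierStokesRegularity.NavierStokesRegularity.Theorems.GaldiLiouville.AllAxesBudget

end
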